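import Mathlib
import Summits.ValiantsHypothesis.ValiantsHypothesis.Theorems.DualUnipotentThreeHalves.Negative.FlagCheapIndexBound

/-!
# Triangularisable affine pencils are flag-cheap (Lemma D in flag currency)

Negative-lane calibration record for crux `GrenetZeon.DualUnipotentThreeHalves`
(stmt-ValiantsHypothesis-24318), line `flag_cost` (S3b `FlagCostLaw`).

**Content.** Let `N` be an entrywise-affine `m × m` pencil over the `n × n` matrix variables which is
*simultaneously triangularisable by a constant matrix*: some `P ∈ GL_m(ℂ)` makes `P·N·P⁻¹` strictly upper
triangular as a polynomial matrix.  Cut `{0,…,m-1}` into consecutive blocks of size `h` and let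
`K := {v : the linear part P·N_lin(v)·P⁻¹ has zero entries inside every diagonal block}`.  Then on every line
`x + s v`, `v ∈ K`, the CONSTANT flag `g = P`, `lvl i = (m-1-i)/h`, `r = a = 0`, `p = m/h + 1` is adapted
(constant part block-upper-triangular, top part strictly block-upper-triangular), its budget is `m/h`, and
`dim K ≥ n² − m(h−1)`.  Hence

* `flagCheap_of_triangularisable_blocks`: for ANY block size `h ≥ 1` with `(m/h + 1)·n + m·(h−1) < n²`
  the pencil is `FlagCheap n m N` (stated with the line's definitions unfolded verbatim, as in
  `FlagCheapIndexBound`);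
* `flagCheap_of_triangularisable`: the closed form `16·m² ≤ n³ ∧ 4 ≤ n` suffices (`h = ⌊√n⌋`).

On paper the optimal block size `h ≈ √(2n)` and the exact pair count `m(h−1)/2` give the threshold
`m² < n³/2` (asymptotically; `3m² ≤ n³` for `n ≥ 8`); the Lean statements trade the constant for a
division-free proof.  Composed with the line's proved S3a (`runBound_proof`) this is
«triangularisable ⇒ the `SlowPlane` conclusion», i.e. S3/S3b have content ONLY for non-triangularisable
(wild) pencils.  Nilpotency of the pencil is not even used: strict triangularity of `P·N·P⁻¹` is.

No summit statement is proved here; 24318 stays OPEN.  Mathlib + the landed Negative file only; no new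
definitions. [folklore]
-/

set_option linter.dupNamespace false
set_option autoImplicit false

namespace Summit.ValiantsHypothesis.ValiantsHypothesis.Theorems.DualUnipotentThreeHalvesNegative.FlagCost

open MvPolynomial

/-- Along an affine line the substituted AFFINE polynomial has no coefficients of `s`-degree `≥ 2`. -/
theorem coeff_aeval_line_eq_zero_of_two_le {σ : Type*} [Fintype σ] (q : MvPolynomial σ ℂ)
    (hq : q.totalDegree ≤ 1) (x v : σ → ℂ) (d : Fin 1 →₀ ℕ) (hd : 2 ≤ d 0) :
    coeff d (aeval (fun c => (C (x c) + ∑ t : Fin 1, C (v c) * X t : MvPolynomial (Fin 1) ℂ)) q) = 0 := by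
  classical
  have h0d : ¬ ((0 : Fin 1 →₀ ℕ) = d) := by
    intro h; rw [← h] at hd; simp at hd
  have h1d : ¬ (Finsupp.single (0 : Fin 1) 1 = d) := by
    intro h; rw [← h] at hd; simp at hd
  conv_lhs =>
    rw [Literature.Computability.AlgebraicComplexity.DeterminantalConormal.eq_C_add_sum_of_totalDegree_le_one hq]
  simp only [map_add, map_sum, map_mul, aeval_C, aeval_X, algebraMap_eq, Fin.sum_univ_zero, Fin.sum_univ_succ,
    add_zero, coeff_add, coeff_sum, coeff_C_mul, coeff_C, if_neg h0d, mul_add, mul_zero, coeff_X,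
    if_neg h1d, Finset.sum_const_zero]

/-- Conjugation by constant matrices commutes with an entrywise algebra-hom substitution. -/
theorem map_conj_algHom {m : ℕ} {σ τ : Type*} (φ : MvPolynomial σ ℂ →ₐ[ℂ] MvPolynomial τ ℂ)
    (G G' : Matrix (Fin m) (Fin m) ℂ) (N : Matrix (Fin m) (Fin m) (MvPolynomial σ ℂ)) :
    (G.map C * N * G'.map C).map φ = G.map C * N.map φ * G'.map C := by
  have h : ((φ : MvPolynomial σ ℂ → MvPolynomial τ ℂ) ∘ (C : ℂ → MvPolynomial σ ℂ)) =
      (C : ℂ → MvPolynomial τ ℂ) := funext fun a => by simp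
  rw [Matrix.map_mul, Matrix.map_mul, Matrix.map_map, Matrix.map_map, h]

/-- Two indices in the same block of consecutive size-`h` blocks are `< h` apart. -/
theorem sub_lt_of_div_eq_div {a b h : ℕ} (hh : 0 < h) (hab : a ≤ b) (he : a / h = b / h) : b - a < h := by
  have ha := Nat.div_add_mod a h
  have hb := Nat.div_add_mod b h
  have hm := Nat.mod_lt b hh
  rw [he] at ha
  generalize h * (b / h) = t at ha hb
  omega

/-- **Lemma D, block form.**  A simultaneously triangularisable entrywise-affine pencil is `FlagCheap n m N`
(line `flag_cost`, unfolded) as soon as some block size `h ≥ 1` satisfies `(m/h + 1)·n + m·(h−1) < n²`: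
take `K = {v : P N_lin(v) P⁻¹ vanishes inside the diagonal h-blocks}`, `k = m/h`, and on every line the constant
flag `g = P`, `lvl i = (m−1−i)/h`, `p = m/h + 1`, `r = a = 0`. -/
theorem flagCheap_of_triangularisable_blocks {n m : ℕ}
    (N : Matrix (Fin m) (Fin m) (MvPolynomial (Fin n × Fin n) ℂ))
    (hN : ∀ i j, (N i j).totalDegree ≤ 1)
    (P : (Matrix (Fin m) (Fin m) ℂ)ˣ)
    (htri : ∀ i j : Fin m, j ≤ i →
      ((P : Matrix (Fin m) (Fin m) ℂ).map C * N * (↑P⁻¹ : Matrix (Fin m) (Fin m) ℂ).map C :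
        Matrix (Fin m) (Fin m) (MvPolynomial (Fin n × Fin n) ℂ)) i j = 0)
    (h : ℕ) (hh : 1 ≤ h) (hbudget : (m / h + 1) * n + m * (h - 1) < n ^ 2) :
    ∃ (K : Submodule ℂ (Fin n × Fin n → ℂ)) (k : ℕ),
      (∀ x v : Fin n × Fin n → ℂ, v ∈ K →
        ∃ (g : (Matrix (Fin m) (Fin m) ℂ)ˣ) (lvl : Fin m → ℕ) (p r a : ℕ),
          (∀ i, lvl i < p) ∧ (p - 1 + r * (n - 1)) / (a + 1) ≤ k ∧
          ∀ (i j : Fin m) (d : Fin 1 →₀ ℕ),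
            coeff d (((g : Matrix (Fin m) (Fin m) ℂ).map C *
              N.map (aeval fun c => (C (x c) + ∑ t : Fin 1, C (v c) * X t : MvPolynomial (Fin 1) ℂ)) *
              (↑g⁻¹ : Matrix (Fin m) (Fin m) ℂ).map C : Matrix (Fin m) (Fin m) (MvPolynomial (Fin 1) ℂ)) i j) ≠ 0 →
              (a + 1) * d 0 + lvl j ≤ lvl i + r) ∧
      (k + 1) * n < Module.finrank ℂ K := by
  classical
  -- block levels
  obtain ⟨lvl, hlvl⟩ : ∃ lvl : Fin m → ℕ, ∀ i, lvl i = (m - 1 - (i : ℕ)) / h := ⟨_, fun _ => rfl⟩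
  have hanti : ∀ i j : Fin m, i < j → lvl j ≤ lvl i := fun i j hij => by
    rw [hlvl, hlvl]; exact Nat.div_le_div_right (by omega)
  have hnear : ∀ i j : Fin m, i < j → lvl i = lvl j → (j : ℕ) - i < h := fun i j hij he => by
    have hj := j.isLt
    have h1 : (m - 1 - (i : ℕ)) - (m - 1 - (j : ℕ)) < h :=
      sub_lt_of_div_eq_div hh (by omega) (by rw [← hlvl, ← hlvl]; exact he.symm)
    omega
  -- the conjugated linear part, as a linear map
  obtain ⟨f, hf⟩ : ∃ f : (Fin n × Fin n → ℂ) → Matrix (Fin m) (Fin m) ℂ, ∀ v,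
      f v = (P : Matrix (Fin m) (Fin m) ℂ) *
        Matrix.of (fun i j => ∑ c, v c * coeff (Finsupp.single c 1) (N i j)) * (↑P⁻¹ : Matrix (Fin m) (Fin m) ℂ) :=
    ⟨_, fun _ => rfl⟩
  have hflin : IsLinearMap ℂ f := by
    constructor
    · intro v w
      have e : (Matrix.of fun i j => ∑ c, (v + w) c * coeff (Finsupp.single c 1) (N i j)) =
          (Matrix.of fun i j => ∑ c, v c * coeff (Finsupp.single c 1) (N i j)) +
          Matrix.of fun i j => ∑ c, w c * coeff (Finsupp.single c 1) (N i j) := by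
        ext i j; simp [Matrix.add_apply, add_mul, Finset.sum_add_distrib]
      rw [hf, hf, hf, e, Matrix.mul_add, Matrix.add_mul]
    · intro a v
      have e : (Matrix.of fun i j => ∑ c, (a • v) c * coeff (Finsupp.single c 1) (N i j)) =
          a • Matrix.of fun i j => ∑ c, v c * coeff (Finsupp.single c 1) (N i j) := by
        ext i j; simp [Matrix.smul_apply, Finset.mul_sum, mul_assoc]
      rw [hf, hf, e, Matrix.mul_smul, Matrix.smul_mul]
  obtain ⟨T, hT⟩ : ∃ T : (Fin n × Fin n → ℂ) →ₗ[ℂ] Matrix (Fin m) (Fin m) ℂ, ∀ v,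
      T v = (P : Matrix (Fin m) (Fin m) ℂ) *
        Matrix.of (fun i j => ∑ c, v c * coeff (Finsupp.single c 1) (N i j)) * (↑P⁻¹ : Matrix (Fin m) (Fin m) ℂ) :=
    ⟨IsLinearMap.mk' f hflin, fun v => by rw [IsLinearMap.mk'_apply, hf]⟩
  -- the within-block entries of the conjugated linear part, as a linear map to coordinates
  obtain ⟨l, hl⟩ : ∃ l : (Fin n × Fin n → ℂ) → ({q : Fin m × Fin m // q.1 < q.2 ∧ lvl q.1 = lvl q.2} → ℂ),
      ∀ v q, l v q = T v q.1.1 q.1.2 := ⟨fun v q => T v q.1.1 q.1.2, fun _ _ => rfl⟩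
  have hllin : IsLinearMap ℂ l := by
    constructor
    · intro v w; funext q; rw [Pi.add_apply, hl, hl, hl, map_add, Matrix.add_apply]
    · intro a v; funext q; rw [Pi.smul_apply, hl, hl, map_smul, Matrix.smul_apply, smul_eq_mul]
  obtain ⟨L, hL⟩ : ∃ L : (Fin n × Fin n → ℂ) →ₗ[ℂ]
      ({q : Fin m × Fin m // q.1 < q.2 ∧ lvl q.1 = lvl q.2} → ℂ), ∀ v q, L v q = T v q.1.1 q.1.2 :=
    ⟨IsLinearMap.mk' l hllin, fun v q => by rw [IsLinearMap.mk'_apply, hl]⟩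
  -- counting the within-block pairs
  have hcard : Fintype.card {q : Fin m × Fin m // q.1 < q.2 ∧ lvl q.1 = lvl q.2} ≤ m * (h - 1) := by
    let f : {q : Fin m × Fin m // q.1 < q.2 ∧ lvl q.1 = lvl q.2} → Fin m × Fin (h - 1) := fun q =>
      (q.1.1, ⟨(q.1.2 : ℕ) - q.1.1 - 1, by
        have h1 := hnear q.1.1 q.1.2 q.2.1 q.2.2
        have h2 : (q.1.1 : ℕ) < q.1.2 := q.2.1
        omega⟩)
    have hf : Function.Injective f := by
      rintro ⟨⟨i, j⟩, hij, he⟩ ⟨⟨i', j'⟩, hij', he'⟩ hq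
      simp only [f, Prod.mk.injEq, Fin.mk.injEq] at hq
      obtain ⟨rfl, hq2⟩ := hq
      have h2 : (i : ℕ) < j := hij
      have h2' : (i : ℕ) < j' := hij'
      have : j = j' := Fin.ext (by omega)
      subst this
      rfl
    simpa [Fintype.card_prod, Fintype.card_fin] using Fintype.card_le_of_injective f hf
  refine ⟨LinearMap.ker L, m / h, fun x v hv => ⟨P, lvl, m / h + 1, 0, 0, fun i => ?_, ?_, ?_⟩, ?_⟩
  · -- levels are < p
    rw [hlvl]; exact Nat.lt_succ_of_le (Nat.div_le_div_right (by omega))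
  · -- the budget of the block flag is m / h
    simp only [Nat.add_sub_cancel, zero_mul, add_zero, zero_add, Nat.div_one, le_refl]
  · -- adaptedness
    intro i j d hd
    set φ : MvPolynomial (Fin n × Fin n) ℂ →ₐ[ℂ] MvPolynomial (Fin 1) ℂ :=
      aeval fun c => (C (x c) + ∑ t : Fin 1, C (v c) * X t : MvPolynomial (Fin 1) ℂ) with hφ
    have hij : i < j := by
      rcases lt_or_ge i j with hlt' | hle
      · exact hlt'
      · exfalso
        apply hd
        rw [← map_conj_algHom φ, Matrix.map_apply, htri i j hle, map_zero, coeff_zero]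
    have hcoeff := coeff_conj_apply (P : Matrix (Fin m) (Fin m) ℂ) (↑P⁻¹ : Matrix (Fin m) (Fin m) ℂ)
      (N.map φ) d i j
    have hji := hanti i j hij
    rcases Nat.lt_or_ge (d 0) 2 with hlt | hge
    · rcases Nat.lt_or_ge (d 0) 1 with h0 | h1
      · have hd0 : d 0 = 0 := by omega
        rw [hd0, mul_zero, zero_add, add_zero]
        exact hji
      · have hd1 : d 0 = 1 := by omega
        have hdeq : d = Finsupp.single 0 1 := Finsupp.ext fun t => by
          fin_cases t; simp [hd1]
        have htop : coeff d (((P : Matrix (Fin m) (Fin m) ℂ).map C * N.map φ *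
            (↑P⁻¹ : Matrix (Fin m) (Fin m) ℂ).map C : Matrix (Fin m) (Fin m) (MvPolynomial (Fin 1) ℂ)) i j) =
            T v i j := by
          rw [hcoeff, hdeq, hφ, top_map_aeval_line_eq_linPart N hN x v, hT]
        have hne : lvl i ≠ lvl j := by
          intro he
          have h0 := congr_fun (LinearMap.mem_ker.mp hv) ⟨(i, j), hij, he⟩
          rw [hL, Pi.zero_apply] at h0
          exact hd (htop.trans h0)
        have hlt' : lvl j < lvl i := lt_of_le_of_ne hji (Ne.symm hne)
        rw [hd1]; omega
    · exfalso
      apply hd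
      rw [hcoeff]
      have hz : (N.map φ).map (coeff d) = 0 := by
        ext a b
        simp only [Matrix.map_apply, Matrix.zero_apply]
        exact coeff_aeval_line_eq_zero_of_two_le _ (hN a b) x v d hge
      rw [hz, Matrix.mul_zero, Matrix.zero_mul, Matrix.zero_apply]
  · -- dimension count: dim K ≥ n² − #pairs ≥ n² − m(h−1) > (m/h + 1)·n
    have h1 := LinearMap.finrank_range_add_finrank_ker L
    have h2 : Module.finrank ℂ (LinearMap.range L) ≤
        Fintype.card {q : Fin m × Fin m // q.1 < q.2 ∧ lvl q.1 = lvl q.2} := by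
      have := Submodule.finrank_le (LinearMap.range L)
      rwa [Module.finrank_fintype_fun_eq_card] at this
    have h3 : Module.finrank ℂ (Fin n × Fin n → ℂ) = n * n := by
      rw [Module.finrank_fintype_fun_eq_card, Fintype.card_prod, Fintype.card_fin]
    have h4 : n ^ 2 = n * n := sq n
    omega

/-- **Lemma D, closed form.**  Every simultaneously triangularisable entrywise-affine `m × m` pencil with
`16·m² ≤ n³` (and `n ≥ 4`) is `FlagCheap n m N` (line `flag_cost`, unfolded): block size `h = ⌊√n⌋`.
So S3b `FlagCostLaw` — and, via the line's proved S3a, S3 `SlowPlane` — has content only for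
non-triangularisable pencils.  (Paper threshold with optimal blocks: `m² < n³/2`.) -/
theorem flagCheap_of_triangularisable {n m : ℕ}
    (N : Matrix (Fin m) (Fin m) (MvPolynomial (Fin n × Fin n) ℂ))
    (hN : ∀ i j, (N i j).totalDegree ≤ 1)
    (P : (Matrix (Fin m) (Fin m) ℂ)ˣ)
    (htri : ∀ i j : Fin m, j ≤ i →
      ((P : Matrix (Fin m) (Fin m) ℂ).map C * N * (↑P⁻¹ : Matrix (Fin m) (Fin m) ℂ).map C :
        Matrix (Fin m) (Fin m) (MvPolynomial (Fin n × Fin n) ℂ)) i j = 0)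
    (hmn : 16 * m ^ 2 ≤ n ^ 3) (hn : 4 ≤ n) :
    ∃ (K : Submodule ℂ (Fin n × Fin n → ℂ)) (k : ℕ),
      (∀ x v : Fin n × Fin n → ℂ, v ∈ K →
        ∃ (g : (Matrix (Fin m) (Fin m) ℂ)ˣ) (lvl : Fin m → ℕ) (p r a : ℕ),
          (∀ i, lvl i < p) ∧ (p - 1 + r * (n - 1)) / (a + 1) ≤ k ∧
          ∀ (i j : Fin m) (d : Fin 1 →₀ ℕ),
            coeff d (((g : Matrix (Fin m) (Fin m) ℂ).map C *
              N.map (aeval fun c => (C (x c) + ∑ t : Fin 1, C (v c) * X t : MvPolynomial (Fin 1) ℂ)) *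
              (↑g⁻¹ : Matrix (Fin m) (Fin m) ℂ).map C : Matrix (Fin m) (Fin m) (MvPolynomial (Fin 1) ℂ)) i j) ≠ 0 →
              (a + 1) * d 0 + lvl j ≤ lvl i + r) ∧
      (k + 1) * n < Module.finrank ℂ K := by
  set s := Nat.sqrt n with hs
  have hs0 : 1 ≤ s := Nat.sqrt_pos.mpr (by omega)
  have hs1 : s * s ≤ n := Nat.sqrt_le n
  have hs2 : n < (s + 1) * (s + 1) := Nat.lt_succ_sqrt n
  refine flagCheap_of_triangularisable_blocks N hN P htri s hs0 ?_
  have hA : m / s * n ≤ m * s + 2 * m :=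
    calc m / s * n ≤ m / s * (s * (s + 2)) := Nat.mul_le_mul_left _ (by nlinarith [hs2])
      _ = (m / s * s) * (s + 2) := by ring
      _ ≤ m * (s + 2) := Nat.mul_le_mul_right _ (Nat.div_mul_le_self m s)
      _ = m * s + 2 * m := by ring
  have hB : 4 * (m * s) ≤ n * n := by
    have : (4 * (m * s)) * (4 * (m * s)) ≤ (n * n) * (n * n) :=
      calc (4 * (m * s)) * (4 * (m * s)) = 16 * m ^ 2 * (s * s) := by ring
        _ ≤ 16 * m ^ 2 * n := Nat.mul_le_mul_left _ hs1
        _ ≤ n ^ 3 * n := Nat.mul_le_mul_right _ hmn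
        _ = (n * n) * (n * n) := by ring
    exact Nat.mul_self_le_mul_self_iff.mp this
  have hC : 8 * m ≤ n * n := by
    have : (8 * m) * (8 * m) ≤ (n * n) * (n * n) :=
      calc (8 * m) * (8 * m) = 4 * (16 * m ^ 2) := by ring
        _ ≤ 4 * n ^ 3 := Nat.mul_le_mul_left _ hmn
        _ ≤ n * n ^ 3 := Nat.mul_le_mul_right _ hn
        _ = (n * n) * (n * n) := by ring
    exact Nat.mul_self_le_mul_self_iff.mp this
  have hD : m * (s - 1) = m * s - m := by
    rw [Nat.mul_sub, mul_one]
  have hE : 4 * n ≤ n * n := Nat.mul_le_mul_right n hn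
  have h4 : n ^ 2 = n * n := sq n
  have h5 : (m / s + 1) * n = m / s * n + n := by ring
  rw [h5, hD, h4]
  omega

end Summit.ValiantsHypothesis.ValiantsHypothesis.Theorems.DualUnipotentThreeHalvesNegative.FlagCost
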